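import Summits.PneNP.PneNP.Theorems.SymmetryBudgetNoHiddenOrderDecodeWalkDefs
import Summits.PneNP.PneNP.Theorems.SymmetryBudgetNoHiddenOrderPerPathAtomsPartition

/-!
# `NoHiddenOrder` (stmt-PneNP-14781), (R2c) value layer II: the replay decoding IS the walk

Route `PneNP/SymmetryBudget`; definitions in `SymmetryBudgetNoHiddenOrderDecodeWalkDefs.lean`.  Main result
`CGBits.replay_eq_result`: for every label `L`, instance `J` and consumed set `C`, after any number `k ≥ pot` of steps the
walk started at `(J, C)` reads off exactly `CertifiedLabels.replay (cgProcess G) L J C` (as a block with a colouring); in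
particular (`CGBits.replay_eq_result_root`) the decoding map of the scheme is the result of `2·|V|` walk steps from the root.
The proof follows the recursion of `replay`: a stop state is frozen; a leaf dies; at a section node the part containing `U`
exists iff all of `U` lies in one switching component (`AndOK`), and then it is the component `andBlock`; at an
individualisation node the "unique `λ`-maximal candidate" of `replay` is the dominating candidate `Dom` of the walk.
(Labels with `U = ∅` never decode and their walk never stops alive.)  Sorry-free; supports stmt-PneNP-14781.
-/

set_option linter.dupNamespace false -- `Summit.PneNP.PneNP.…` (D-0017 single-conjunct layout)

namespace Summit.PneNP.PneNP.Theorems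

open Finset BranchSum

namespace CGBits

open WState

variable {V : Type*} [DecidableEq V] {G : SimpleGraph V} [DecidableRel G.Adj] {L : CertifiedLabels.Label V}

/-! ### Frozen states -/

/-- A dead state is frozen. [folklore] -/
theorem wstep_of_dead {S : WState V} (h : S.dead = true) : wstep G L S = S := by
  unfold wstep; rw [if_pos h]

/-- A stopped state is frozen. [folklore] -/
theorem wstep_of_stop {S : WState V} (h : Stop L S) : wstep G L S = S := by
  unfold wstep
  split_ifs <;> rfl

/-- One more step of the walk, taken at the head. [folklore] -/
theorem walk_succ (S : WState V) (k : ℕ) : walk G L S (k + 1) = walk G L (wstep G L S) k := by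
  unfold walk; rw [Function.iterate_succ_apply]

/-- A frozen state stays. [folklore] -/
theorem walk_of_fixed {S : WState V} (h : wstep G L S = S) (k : ℕ) : walk G L S k = S := by
  induction k with
  | zero => rfl
  | succ k ih => rw [walk_succ, h, ih]

/-- The result of a dead state. [folklore] -/
theorem result_of_dead {S : WState V} (h : S.dead = true) : result L S = none := by
  unfold result; rw [if_neg]; simp [h]

/-- The result of a live stopped state. [folklore] -/
theorem result_of_stop {S : WState V} (hd : S.dead = false) (h : Stop L S) : result L S = some (S.A, S.col) := by
  unfold result; rw [if_pos ⟨hd, h⟩]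

/-- The result of a live state that has not stopped. [folklore] -/
theorem result_of_not_stop {S : WState V} (h : ¬ Stop L S) : result L S = none := by
  unfold result; rw [if_neg]; exact fun h' => h h'.2

/-- Killing a state and walking on gives no result. [folklore] -/
theorem result_walk_dead (S : WState V) (k : ℕ) : result L (walk G L { S with dead := true } k) = none := by
  rw [walk_of_fixed (wstep_of_dead rfl), result_of_dead rfl]

/-! ### The step conditions versus `cgStep` -/

/-- A leaf is neither a section nor an individualisation node. [folklore] -/
theorem cgStep_eq_leaf_iff (I : CGInst V) : cgStep G I = .leaf ↔
    (¬ ∃ u ∈ I.1.1, swReach G I.1.1 I.1.2 u ≠ I.1.1) ∧ ¬ (1 < I.1.1.card ∧ 2 ≤ (smallestCell I.1.1 I.1.2).card) := by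
  unfold cgStep
  split_ifs with h1 h2
  · exact ⟨fun h => (by cases h), fun h => absurd h1 h.1⟩
  · exact ⟨fun h => (by cases h), fun h => absurd h2 h.2⟩
  · exact ⟨fun _ => ⟨h1, h2⟩, fun _ => rfl⟩

/-- **The unique-maximum filter of `replay` is a domination predicate**: the filter of the `λ`-maximal elements of `T` is
the singleton `{y}` iff `y ∈ T` and every other element of `T` has a strictly smaller value (with `T` the candidates, this is
`Dom`). [folklore] -/
theorem filter_max_eq_singleton_iff (T : Finset V) (lam : V → ℕ) (y : V) [DecidablePred fun y' => ∀ z ∈ T, lam z ≤ lam y'] :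
    T.filter (fun y' => ∀ z ∈ T, lam z ≤ lam y') = {y} ↔ y ∈ T ∧ ∀ z ∈ T, z ≠ y → lam z < lam y := by
  constructor
  · intro h
    have hy : y ∈ T.filter fun y' => ∀ z ∈ T, lam z ≤ lam y' := by rw [h]; exact mem_singleton_self _
    obtain ⟨hyc, hmax⟩ := mem_filter.1 hy
    refine ⟨hyc, fun z hz hzy => lt_of_le_of_ne (hmax z hz) fun heq => hzy ?_⟩
    have hz' : z ∈ T.filter fun y' => ∀ z ∈ T, lam z ≤ lam y' :=
      mem_filter.2 ⟨hz, fun w hw => (hmax w hw).trans heq.ge⟩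
    rw [h] at hz'
    exact mem_singleton.1 hz'
  · rintro ⟨hyc, hlt⟩
    ext z
    simp only [mem_filter, mem_singleton]
    constructor
    · rintro ⟨hz, hmax⟩
      by_contra hzy
      exact absurd (hmax y hyc) (not_le.2 (hlt z hz hzy))
    · rintro rfl
      refine ⟨hyc, fun w hw => ?_⟩
      by_cases hwy : w = z
      · rw [hwy]
      · exact (hlt w hw hwy).le

/-- Domination is unique. [folklore] -/
theorem dom_unique {S : WState V} {y y' : V} (hy : Dom L S y) (hy' : Dom L S y') : y = y' := by
  by_contra hne
  have h1 := hy.2 y' hy'.1 (Ne.symm hne)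
  have h2 := hy'.2 y hy.1 hne
  omega

/-! ### Labels with empty vertex set never decode -/

/-- A label with `U = ∅` never replays to an instance (instances are non-empty). [folklore] -/
theorem replay_eq_none_of_empty [Fintype V] (hU : L.U = ∅) (J : CGInst V) (C : Finset V) :
    CertifiedLabels.replay (cgProcess G) L J C = none := by
  suffices key : ∀ m (J : CGInst V) (C : Finset V),
      J.1.1.card * (Fintype.card V + 1) + (Fintype.card V - C.card) = m →
        CertifiedLabels.replay (cgProcess G) L J C = none from key _ J C rfl
  intro m
  induction m using Nat.strong_induction_on with
  | _ m ih =>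
  intro J C hm
  rw [CertifiedLabels.replay]
  have hstop : ¬ ((cgProcess G).verts J = L.U ∧ C = L.X) := fun h => by
    have hne : ((cgProcess G).verts J).Nonempty := J.2
    rw [h.1, hU] at hne
    exact not_nonempty_empty hne
  rw [if_neg hstop]
  split
  · rfl
  · rename_i ps hstep
    split_ifs with h
    · refine ih _ ?_ h.choose C rfl
      have h1 := card_lt_card h.choose_spec.2.2
      have h3 : (((cgProcess G).verts h.choose).card + 1) * (Fintype.card V + 1) ≤
          ((cgProcess G).verts J).card * (Fintype.card V + 1) := Nat.mul_le_mul_right _ h1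
      rw [← hm]
      change ((cgProcess G).verts h.choose).card * _ + _ < ((cgProcess G).verts J).card * _ + _
      nlinarith
    · rfl
  · rename_i A ch hstep
    split_ifs with h hg
    · refine ih _ ?_ (ch h.choose) (insert h.choose C) rfl
      rw [← hm]
      change ((cgProcess G).verts (ch h.choose)).card * _ + _ < ((cgProcess G).verts J).card * _ + _
      rw [hg.1]
      have h1 : (insert h.choose C).card = C.card + 1 := card_insert_of_notMem hg.2
      have h2 : (insert h.choose C).card ≤ Fintype.card V := card_le_univ _
      omega
    · rfl
    · rfl

/-! ### The section step -/

/-- **At a section node, the part containing `U` exists iff the AND-step of the walk is possible**, and then it is the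
component `andBlock`. [folklore] -/
theorem and_step {J : CGInst V} (hdisc : ∃ u ∈ J.1.1, swReach G J.1.1 J.1.2 u ≠ J.1.1) (hU : L.U.Nonempty) (C : Finset V) :
    ((∃ J' ∈ cgParts G J, L.U ⊆ (cgProcess G).verts J' ∧ (cgProcess G).verts J' ⊂ (cgProcess G).verts J) ↔
      AndOK G L (start J C)) ∧
    ∀ h : ∃ J' ∈ cgParts G J, L.U ⊆ (cgProcess G).verts J' ∧ (cgProcess G).verts J' ⊂ (cgProcess G).verts J,
      h.choose.1.1 = andBlock G L (start J C) ∧ h.choose.1.2 = J.1.2 := by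
  have key : ∀ J' ∈ cgParts G J, L.U ⊆ J'.1.1 → AndOK G L (start J C) ∧ J'.1.1 = andBlock G L (start J C) := by
    intro J' hJ' hUJ'
    obtain ⟨hcol, hK⟩ := mem_cgParts_iff.1 hJ'
    obtain ⟨a, ha, hKa⟩ := mem_image.1 hK
    have hsw : ∀ u ∈ L.U, swReach G J.1.1 J.1.2 u = J'.1.1 := fun u hu => by
      rw [← hKa]; exact swReach_eq_of_mem _ ha (hKa ▸ hUJ' hu)
    refine ⟨⟨hU, fun u hu u' hu' => ?_⟩, ?_⟩
    · show u' ∈ swReach G J.1.1 J.1.2 u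
      rw [hsw u hu]; exact hUJ' hu'
    · ext w
      unfold andBlock
      simp only [start, mem_filter]
      constructor
      · intro hw
        obtain ⟨u, hu⟩ := hU
        have hw' : w ∈ swReach G J.1.1 J.1.2 a := by rw [hKa]; exact hw
        exact ⟨swReach_subset _ _ a hw', u, hu, by rw [hsw u hu]; exact hw⟩
      · rintro ⟨-, u, hu, hw⟩
        rw [← hsw u hu]; exact hw
  refine ⟨⟨fun ⟨J', hJ', hUJ', _⟩ => (key J' hJ' hUJ').1, fun hok => ?_⟩, fun h => ?_⟩
  · obtain ⟨u₀, hu₀⟩ := hU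
    have hu₀A : u₀ ∈ J.1.1 := swReach_subset _ _ _ (hok.2 u₀ hu₀ u₀ hu₀)
    have himg : swReach G J.1.1 J.1.2 u₀ ∈ J.1.1.image fun u => swReach G J.1.1 J.1.2 u :=
      mem_image_of_mem (fun u => swReach G J.1.1 J.1.2 u) hu₀A
    let J' : CGInst V := ⟨(swReach G J.1.1 J.1.2 u₀, J.1.2), ⟨u₀, self_mem_swReach _ hu₀A⟩⟩
    have hJ'p : J' ∈ cgParts G J := mem_cgParts_iff.2 ⟨rfl, himg⟩
    exact ⟨J', hJ'p, fun u hu => hok.2 u₀ hu₀ u hu, cgParts_ssubset hdisc hJ'p⟩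
  · exact ⟨(key _ h.choose_spec.1 h.choose_spec.2.1).2, (mem_cgParts_iff.1 h.choose_spec.1).1⟩

/-! ### The main theorem -/

omit [DecidableEq V] in
/-- The potential of the start state. [folklore] -/
theorem pot_start [Fintype V] (J : CGInst V) (C : Finset V) : pot (start J C) = J.1.1.card + (Fintype.card V - C.card) := rfl

/-- **The replay of a label is the result of the walk** (from any instance and consumed set, after `≥ pot` steps). [folklore] -/
theorem replay_eq_result [Fintype V] (L : CertifiedLabels.Label V) (J : CGInst V) (C : Finset V) {k : ℕ}
    (hk : pot (start J C) ≤ k) :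
    (CertifiedLabels.replay (cgProcess G) L J C).map (fun I => I.1) = result L (walk G L (start J C) k) := by
  classical
  suffices key : ∀ m (J : CGInst V) (C : Finset V) (k : ℕ), pot (start J C) = m → m ≤ k →
      (CertifiedLabels.replay (cgProcess G) L J C).map (fun I => I.1) = result L (walk G L (start J C) k) from
    key _ J C k rfl hk
  intro m
  induction m using Nat.strong_induction_on with
  | _ m ih =>
  intro J C k hm hmk
  have hpos : 1 ≤ k := by
    rw [← hm, pot_start] at hmk
    have := card_pos.2 J.2
    omega
  obtain ⟨k, rfl⟩ : ∃ k', k = k' + 1 := ⟨k - 1, by omega⟩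
  rw [CertifiedLabels.replay]
  by_cases hstop : (cgProcess G).verts J = L.U ∧ C = L.X
  · -- stop: frozen, read off
    rw [if_pos hstop]
    have hS : Stop L (start J C) := hstop
    rw [walk_of_fixed (wstep_of_stop hS), result_of_stop rfl hS]
    rfl
  rw [if_neg hstop]
  have hS : ¬ Stop L (start J C) := hstop
  split
  · -- leaf: die
    rename_i hstep
    obtain ⟨hA, hO⟩ := (cgStep_eq_leaf_iff J).1 hstep
    have hw : wstep G L (start J C) = { start J C with dead := true } := by
      unfold wstep
      rw [if_neg (by simp [start]), if_neg hS, if_neg (by exact hA), if_neg (fun h => hO h.2)]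
    rw [walk_succ, hw, result_walk_dead]
    rfl
  · -- section node
    rename_i ps hstep
    obtain ⟨hdisc, rfl⟩ := cgStep_eq_andNode_iff.1 hstep
    have hIsAND : IsAND G (start J C) := hdisc
    have hdead : ¬ AndOK G L (start J C) → result L (walk G L (start J C) (k + 1)) = none := fun hok => by
      have hw : wstep G L (start J C) = { start J C with dead := true } := by
        unfold wstep
        rw [if_neg (by simp [start]), if_neg hS, if_pos hIsAND, if_neg hok]
      rw [walk_succ, hw, result_walk_dead]
    split_ifs with h
    · by_cases hU : L.U.Nonempty
      · obtain ⟨hiff, hchoose⟩ := and_step hdisc hU C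
        have hok : AndOK G L (start J C) := hiff.1 h
        have hst : start h.choose C = ⟨andBlock G L (start J C), (start J C).col, (start J C).C, false⟩ := by
          obtain ⟨h1, h2⟩ := hchoose h
          show (⟨h.choose.1.1, h.choose.1.2, C, false⟩ : WState V) = ⟨andBlock G L (start J C), J.1.2, C, false⟩
          rw [WState.mk.injEq]
          exact ⟨h1, h2, rfl, rfl⟩
        have hw : wstep G L (start J C) = start h.choose C := by
          rw [hst]
          unfold wstep
          rw [if_neg (by simp [start]), if_neg hS, if_pos hIsAND, if_pos hok]
        rw [walk_succ, hw]
        refine ih _ ?_ h.choose C k rfl ?_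
        · rw [← hm, pot_start, pot_start]
          have := card_lt_card h.choose_spec.2.2
          exact Nat.add_lt_add_right this _
        · rw [← hm, pot_start] at hmk
          rw [pot_start]
          have := card_lt_card h.choose_spec.2.2
          change h.choose.1.1.card < J.1.1.card at this
          omega
      · -- `U = ∅`: never decodes; the walk dies here
        rw [replay_eq_none_of_empty (not_nonempty_iff_eq_empty.1 hU), hdead fun hok => hU hok.1]
        rfl
    · have hok : ¬ AndOK G L (start J C) := fun hok => by
        by_cases hU : L.U.Nonempty
        · exact h ((and_step hdisc hU C).1.2 hok)
        · exact hU hok.1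
      rw [hdead hok]
      rfl
  · -- individualisation node
    rename_i A ch hstep
    obtain ⟨hconn, hOR, rfl, rfl⟩ := cgStep_eq_orNode_iff.1 hstep
    have hIsAND : ¬ IsAND G (start J C) := hconn
    have hIsOR : IsOR G (start J C) := ⟨hconn, hOR⟩
    have hdead : (¬ ∃ y, Dom L (start J C) y) → result L (walk G L (start J C) (k + 1)) = none := fun hdom => by
      have hw : wstep G L (start J C) = { start J C with dead := true } := by
        unfold wstep
        rw [if_neg (by simp [start]), if_neg hS, if_neg hIsAND, if_pos hIsOR, dif_neg hdom]
      rw [walk_succ, hw, result_walk_dead]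
    split_ifs with h hg
    · have hdomx : Dom L (start J C) h.choose := (filter_max_eq_singleton_iff _ _ _).1 h.choose_spec
      have hdom : ∃ y, Dom L (start J C) y := ⟨_, hdomx⟩
      have hx : hdom.choose = h.choose := dom_unique hdom.choose_spec hdomx
      have hw : wstep G L (start J C) = start (cgChild G J h.choose) (insert h.choose C) := by
        unfold wstep
        rw [if_neg (by simp [start]), if_neg hS, if_neg hIsAND, if_pos hIsOR, dif_pos hdom, hx]
        rfl
      rw [walk_succ, hw]
      have hcard : (insert h.choose C).card = C.card + 1 := card_insert_of_notMem hg.2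
      have hle : (insert h.choose C).card ≤ Fintype.card V := card_le_univ _
      refine ih _ ?_ _ _ k rfl ?_
      · rw [← hm, pot_start, pot_start]
        change J.1.1.card + _ < J.1.1.card + _
        omega
      · rw [← hm, pot_start] at hmk
        rw [pot_start]
        change J.1.1.card + _ ≤ k
        omega
    · exact absurd ⟨rfl, (mem_filter.1 ((filter_max_eq_singleton_iff _ _ _).1 h.choose_spec).1).2.2⟩ hg
    · rw [hdead fun ⟨y, hy⟩ => h ⟨y, (filter_max_eq_singleton_iff _ _ _).2 hy⟩]
      rfl

/-- **The decoding map of the scheme is the result of `2·|V|` walk steps from the root.** [folklore] -/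
theorem replay_eq_result_root [Fintype V] (L : CertifiedLabels.Label V) (I₀ : CGInst V) {k : ℕ}
    (hk : Fintype.card V + Fintype.card V ≤ k) :
    (CertifiedLabels.replay (cgProcess G) L I₀ ∅).map (fun I => I.1) = result L (walk G L (start I₀ ∅) k) :=
  replay_eq_result L I₀ ∅ (by rw [pot_start, card_empty, Nat.sub_zero]; exact (Nat.add_le_add_right (card_le_univ _) _).trans hk)

end CGBits

end Summit.PneNP.PneNP.Theorems
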